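import Summits.FinalStateConjecture.FinalStateConjecture.Theorems.PhaseMixingCaptureNearExtremalKappaCaptureKerrFlatLeafOptics
import Summits.FinalStateConjecture.FinalStateConjecture.Theorems.PhaseMixingCaptureNearExtremalKappaCaptureKerrSlabFarSojournTransfer
import Summits.FinalStateConjecture.FinalStateConjecture.Theorems.PhaseMixingCaptureNearExtremalKappaCaptureCentreConverges
import Summits.FinalStateConjecture.FinalStateConjecture.Theorems.PhaseMixingCaptureNearExtremalKappaCaptureFarCompleteTransport
import Literature.Geometry.Lorentzian.KerrHyperboloidalLeaves
import Literature.Geometry.Lorentzian.KerrData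
import HarnessLib

/-!
# Crux `PhaseMixingCapture.NearExtremalKappaCapture` (stmt-FinalStateConjecture-10606), line
# `unit-temperature-front-face`, stub F3 `stub_captureTransferCentreFarComplete`:
# every maximal vacuum Cauchy development of the EXACT sub-extremal Kerr datum is far-complete

Support file (lead prover-line-stmt-FinalStateConjecture-10606-c2-0, skeleton rev 2.2) for the registered centre
sub-goal F3 of stub S4 `stub_captureTransfer`, clause (v): at `dist = 0` — the datum `Kerr.data M a M` itself,
which lies inside every basin `c·(1 − a²/M²)^γ` of the crux — the crux's first conclusion asks that every
MAXIMAL vacuum Cauchy development of the exact Kerr–Schild slice datum be far-complete in Christodoulou's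
sojourn form (`FarComplete`, the clause verbatim). So far this was "true on paper" only (refuter's
`Centre.lean`, Disproof `captureWith_self`).

Proof (`stub_captureTransferCentreFarComplete`). By the landed transport lemma
(`AreaExcessRatchet.stub_farCompleteTransport`, p102813: maximality embeds any vacuum Cauchy development of the
data into the MGHD, and far-origin sojourn completeness ascends along the embedding) it suffices to exhibit ONE
far-complete vacuum Cauchy development of `Kerr.data M a M`. We take the Kerr slab
`KerrSlab.development hM ha` (p101146: the half-chart `{0 < t* + (r − M)/4}` of `Kerr.region a M` with
`g_{M,a}`, realised in the chart by the inclusion `KerrSlab.incl`, `KerrSlab.incl_realises`: smooth isometric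
time-orientation-preserving open embedding over `Kerr.sliceEmbed`, range `⊇ {t* ≥ 0}`; its normal is
`Kerr.sliceNormal`, `dj ν = ν` by `mfderiv_subtypeVal`). Its far-origin sojourn completeness is the landed
flat-leaf chart optics (F1, `stub_kerrFlatLeafOptics`, p108914: conserved Killing energy, far two-speed
bounds, escape, first exit, banking through `{x⁰ ≥ 2‖x⃗‖ − 14M, ‖x⃗‖ ≥ 10M} ⊆ J⁺(leaf annulus)`) at
`ν = Kerr.sliceNormal M a M` (`Kerr.isFutureUnitNormal_sliceNormal_holds`), transported into the slab by the
landed realisation transfer (F2, `stub_kerrSlabFarSojournTransfer`, p109785). Bookkeeping: the reference set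
`B₀ = {8M ≤ ‖y‖ ≤ 10M}` and the exemption sets `B₁ = {afRadius + 1 ≤ ‖y‖ ≤ max R₁ 0 + |a| + 1}` are compact
norm shells of the slice (`isCompact_shell`), and a far origin outside `B₁` has Kerr–Schild radius `≥ R₁`
(`‖y‖ − |a| ≤ r`).

Corollary (`nearExtremalKappaCapture_centre`): with the landed centre convergence
(`stub_captureTransferCentreConverges`, p106721) the WHOLE conclusion of the crux body holds at the exact datum
for every sub-extremal `(M, a)` and every order `k`, with `(M′, a′) = (M, a)` and modulus `0`:
`Kerr.IsSubextremal M a ∧ FarComplete 𝒟 ∧ ConvergesToKerr 𝒟oc M a k ∧ |M − M| + |a − a| ≤ 0`.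

References: D. Christodoulou, CQG 16 (1999) A23, pp. A26–A27; M. Dafermos, I. Rodnianski, arXiv:0811.0354,
§2.6.2 and §5.1; Y. Choquet-Bruhat, R. Geroch, CMP 14 (1969), Thm. 3; B. O'Neill 1983, Ch. 14, p. 402.
-/

-- lint debt: the summit and the problem are both named `FinalStateConjecture` (tree layout)
set_option linter.dupNamespace false

noncomputable section

open Set Filter MeasureTheory
open scoped Manifold ContDiff Topology
open Literature.Geometry.Lorentzian
open Summit.FinalStateConjecture.FinalStateConjecture.Theorems.NearExtremalKappaCapture.Negative
open Summit.FinalStateConjecture.FinalStateConjecture.Theorems.NearExtremalKappaCapture.AreaExcessRatchet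
  (stub_farCompleteTransport)
open Summit.FinalStateConjecture.FinalStateConjecture.Theorems.SwallowTheDatum.KerrShieldedSettles
  (KerrLeafSojourn.spatialNorm_sub_le_radius)

namespace Summit.FinalStateConjecture.FinalStateConjecture.Theorems.NearExtremalKappaCapture.UnitTemperatureFrontFace

namespace CentreFarComplete

variable {M a : ℝ}

/-- `‖y‖ − |a| ≤ r(0, y)`: the Kerr–Schild radius of a slice point dominates its Euclidean norm minus `|a|`
(`‖x⃗‖² − a² ≤ r²`). [folklore] -/
theorem norm_sub_abs_le_radius (a : ℝ) (y : E3) : ‖y‖ - |a| ≤ Kerr.radius a (E4.ofTimeSpace 0 y) := by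
  have h := KerrLeafSojourn.spatialNorm_sub_le_radius a (E4.ofTimeSpace 0 y)
  rwa [E4.spatialNorm_ofTimeSpace] at h

/-- A point of `E3` in the crux's far region, `Kerr.afRadius a M + 1 = √(M² + a²) + 2 ≤ ‖y‖`, lies in the slice
`Kerr.slice a M` (`0 ≤ M`): `r² ≥ ‖y‖² − a² ≥ (√(M² + a²) + 2)² − a² > M²`. [folklore] -/
theorem mem_slice_of_afRadius_le (hM : 0 ≤ M) {y : E3} (hy : Kerr.afRadius a M + 1 ≤ ‖y‖) :
    y ∈ Kerr.slice a M := by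
  rw [Kerr.mem_slice, max_eq_left hM]
  have h1 := Kerr.spatialNorm_sq_sub_sq_le_radius_sq a (E4.ofTimeSpace 0 y)
  rw [E4.spatialNorm_ofTimeSpace] at h1
  have hr0 : 0 ≤ Kerr.radius a (E4.ofTimeSpace 0 y) := Kerr.radius_nonneg a _
  have haf : Kerr.afRadius a M = √(M ^ 2 + a ^ 2) + 1 := by
    rw [Kerr.afRadius, max_eq_left hM]
  have hy2 : √(M ^ 2 + a ^ 2) + 2 ≤ ‖y‖ := by rw [haf] at hy; linarith
  have hs0 : 0 ≤ √(M ^ 2 + a ^ 2) := Real.sqrt_nonneg _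
  have hsq : (√(M ^ 2 + a ^ 2)) ^ 2 = M ^ 2 + a ^ 2 := Real.sq_sqrt (by positivity)
  have hy3 : (√(M ^ 2 + a ^ 2) + 2) ^ 2 ≤ ‖y‖ ^ 2 := pow_le_pow_left₀ (by positivity) hy2 2
  have hr2 : M ^ 2 < Kerr.radius a (E4.ofTimeSpace 0 y) ^ 2 := by nlinarith
  by_contra hle
  have hle' : Kerr.radius a (E4.ofTimeSpace 0 y) ≤ M := not_lt.1 hle
  have : Kerr.radius a (E4.ofTimeSpace 0 y) ^ 2 ≤ M ^ 2 := pow_le_pow_left₀ hr0 hle' 2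
  linarith

/-- A point of `E3` with `8M ≤ ‖y‖` lies in the slice `Kerr.slice a M` when `|a| < M`
(`r ≥ ‖y‖ − |a| > 7M ≥ M`). [folklore] -/
theorem mem_slice_of_eight_mul_le (ha : |a| < M) {y : E3} (hy : 8 * M ≤ ‖y‖) : y ∈ Kerr.slice a M := by
  have hM : 0 ≤ M := (abs_nonneg a).trans ha.le
  rw [Kerr.mem_slice, max_eq_left hM]
  have := norm_sub_abs_le_radius a y
  linarith

/-- **Compact norm shells of the slice.** If every point of `E3` with `c₁ ≤ ‖y‖` lies in the slice, the shell
`{c₁ ≤ ‖y‖ ≤ c₂}` is a compact subset of the slice `Kerr.slice a M`: it is the preimage under `Subtype.val` of a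
closed bounded subset of `E3` contained in the (open) slice, and compactness is intrinsic along the embedding.
[folklore] -/
theorem isCompact_shell {c₁ c₂ : ℝ} (hmem : ∀ y : E3, c₁ ≤ ‖y‖ → y ∈ Kerr.slice a M) :
    IsCompact {y' : Kerr.slice a M | c₁ ≤ ‖(y' : E3)‖ ∧ ‖(y' : E3)‖ ≤ c₂} := by
  set K : Set E3 := {y : E3 | c₁ ≤ ‖y‖} ∩ Metric.closedBall (0 : E3) c₂ with hK
  have hKc : IsCompact K :=
    (isCompact_closedBall (0 : E3) c₂).inter_left (isClosed_le continuous_const continuous_norm)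
  have hKs : K ⊆ (Kerr.slice a M : Set E3) := fun y hy ↦ hmem y hy.1
  have hpre : {y' : Kerr.slice a M | c₁ ≤ ‖(y' : E3)‖ ∧ ‖(y' : E3)‖ ≤ c₂} =
      (Subtype.val : Kerr.slice a M → E3) ⁻¹' K := by
    ext y'
    simp only [hK, mem_setOf_eq, mem_preimage, mem_inter_iff, Metric.mem_closedBall, dist_zero_right]
  rw [hpre]
  refine Topology.IsEmbedding.subtypeVal.isCompact_iff.2 ?_
  rwa [image_preimage_eq_inter_range, Subtype.range_coe, inter_eq_left.2 hKs]

/-- **The Kerr slab development is far-complete** (`FarComplete (KerrSlab.development hM ha)`): the flat-leaf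
chart optics (F1) at `ν = Kerr.sliceNormal`, transported into the slab along the inclusion (F2,
`KerrSlab.incl_realises`, `dj ν = ν` by `mfderiv_subtypeVal`), with the compact shells
`B₀ = {8M ≤ ‖y‖ ≤ 10M}`, `B₁ = {afRadius + 1 ≤ ‖y‖ ≤ max R₁ 0 + |a| + 1}` and the far-origin radius bound
`r ≥ ‖y‖ − |a| ≥ R₁`. Dafermos–Rodnianski arXiv:0811.0354, §5.1; Christodoulou, CQG 16 (1999), pp. A26–A27.
[cite: arXiv08110354, §5.1] -/
theorem farComplete_kerrSlab [Kerr.Facts] [Kerr.SliceFacts] (hM : 0 < M) (ha : |a| < M) :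
    FarComplete (KerrSlab.development hM ha) := by
  intro inst𝒦
  -- the slab is realised in the chart by the inclusion, over the flat leaf, with normal `Kerr.sliceNormal`
  obtain ⟨hjs, hjo, hiso, hτ, hjι, hrange⟩ := KerrSlab.incl_realises hM ha
  have hjν : ∀ y : Kerr.slice a M, mfderiv (𝓡 4) 𝓘(ℝ, E4) (KerrSlab.incl hM ha)
      ((KerrSlab.development hM ha).embed y) ((KerrSlab.development hM ha).normal y) =
        Kerr.sliceNormal M a M y := by
    intro y
    change mfderiv (𝓡 4) (𝓡 4) (Subtype.val : KerrSlab.domain a M → Kerr.region a M)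
        ((KerrSlab.development hM ha).embed y) ((Kerr.dataEmbedding M a M hM.le).normal y) = _
    rw [mfderiv_subtypeVal]
    rfl
  have hν := Kerr.isFutureUnitNormal_sliceNormal_holds M a M hM.le
  -- F2 fed with F1
  have H := stub_kerrSlabFarSojournTransfer M a hM ha (Kerr.sliceNormal M a M) hν
    (KerrSlab.development hM ha) (KerrSlab.incl hM ha) ⟨hjs, hjo, hiso, hτ, hjι, hjν, hrange⟩
    (fun s hs ↦ stub_kerrFlatLeafOptics M a hM.le ha (Kerr.sliceNormal M a M) hν s hs)
  refine ⟨{y' : Kerr.slice a M | 8 * M ≤ ‖(y' : E3)‖ ∧ ‖(y' : E3)‖ ≤ 10 * M},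
    isCompact_shell (fun y hy ↦ mem_slice_of_eight_mul_le ha hy), fun σ hσ ↦ ?_⟩
  obtain ⟨R₁, hR₁⟩ := H σ hσ
  refine ⟨{y' : Kerr.slice a M | Kerr.afRadius a M + 1 ≤ ‖(y' : E3)‖ ∧
      ‖(y' : E3)‖ ≤ max R₁ 0 + |a| + 1},
    isCompact_shell (fun y hy ↦ mem_slice_of_afRadius_le hM.le hy), fun q hq hqB ray dom hray ↦ ?_⟩
  -- a far origin outside `B₁` has `‖q‖ > max R₁ 0 + |a| + 1`, hence radius `≥ R₁`
  have hqn : max R₁ 0 + |a| + 1 < ‖(q : E3)‖ := by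
    by_contra h
    exact hqB ⟨hq, not_lt.1 h⟩
  have hrad : R₁ ≤ Kerr.radius a (E4.ofTimeSpace 0 (q : E3)) := by
    have h1 := norm_sub_abs_le_radius a (q : E3)
    linarith [le_max_left R₁ 0]
  exact hR₁ q hrad ray dom hray

end CentreFarComplete

open CentreFarComplete in
/-- **F3 · `stub_captureTransferCentreFarComplete` — the centre case of S4 (v): every MAXIMAL vacuum Cauchy
development of the exact sub-extremal Kerr datum `Kerr.data M a M` (`0 < M`, `|a| < M`) is far-complete in
Christodoulou's sojourn form (`FarComplete`, the crux's clause verbatim).** The far-complete Kerr slab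
development (`farComplete_kerrSlab`) embeds into the MGHD by maximality, and far-completeness ascends along the
embedding (`AreaExcessRatchet.stub_farCompleteTransport`). This is the `dist = 0` instance of the first conclusion
of `NearExtremalKappaCapture` — every Kerr datum lies in every basin — hitherto only "true on paper"
(Disproof `captureWith_self`). Choquet-Bruhat–Geroch, CMP 14 (1969), Thm. 3; Christodoulou, CQG 16 (1999),
pp. A26–A27. [cite: ChoquetBruhatGeroch1969CMP, Thm. 3 (p. 332)] -/
theorem stub_captureTransferCentreFarComplete : ∀ [Kerr.Facts] [Kerr.SliceFacts] (M : ℝ) (hM : 0 < M) (a : ℝ),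
    Kerr.IsSubextremal M a → ∀ 𝒟 : VacuumCauchyDevelopment (Kerr.data M a M hM.le), 𝒟.IsMaximal →
    FarComplete 𝒟 := by
  intro _ _ M hM a ha 𝒟 h𝒟
  have ha' : |a| < M := ha
  -- (type ascription keeps the instance binder of `FarComplete` un-instantiated)
  have hfar : FarComplete (KerrSlab.development hM ha') := farComplete_kerrSlab hM ha'
  intro instD
  exact stub_farCompleteTransport h𝒟 (KerrSlab.development hM ha') hfar

/-- **The crux body at its centre, unconditionally.** For every sub-extremal `(M, a)` (`0 < M`), every order
`k` and every MAXIMAL vacuum Cauchy development `𝒟` of the exact Kerr–Schild slice datum `Kerr.data M a M`, the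
conclusion of `NearExtremalKappaCapture` holds with `(M′, a′) = (M, a)` and modulus `0`: `(M, a)` is
sub-extremal, `𝒟` is far-complete (`stub_captureTransferCentreFarComplete`), a region of `𝒟` converges in `Cᵏ`
to `g_{M,a}` (`stub_captureTransferCentreConverges`, p106721), and `|M − M| + |a − a| ≤ 0`. I.e. the exact
Kerr datum is captured at EVERY exponent vector — the consistency statement `captureWith_self` of the disprover,
now a theorem rather than a paper fact. [cite: ChoquetBruhatGeroch1969CMP, Thm. 3 (p. 332)] -/
theorem nearExtremalKappaCapture_centre : ∀ [Kerr.Facts] [Kerr.SliceFacts] (k : ℕ) (M : ℝ) (hM : 0 < M) (a : ℝ),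
    Kerr.IsSubextremal M a → ∀ 𝒟 : VacuumCauchyDevelopment (Kerr.data M a M hM.le), 𝒟.IsMaximal →
    ∃ (M' a' : ℝ) (𝒟oc : Set 𝒟.carrier), Kerr.IsSubextremal M' a' ∧ FarComplete 𝒟 ∧
      𝒟.toSpacetime.ConvergesToKerr 𝒟oc M' a' k ∧ |M' - M| + |a' - a| ≤ 0 := by
  intro _ _ k M hM a ha 𝒟 h𝒟
  obtain ⟨𝒟oc, hconv⟩ := stub_captureTransferCentreConverges k M hM a ha 𝒟 h𝒟
  exact ⟨M, a, 𝒟oc, ha, stub_captureTransferCentreFarComplete M hM a ha 𝒟 h𝒟, hconv, by simp⟩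

end Summit.FinalStateConjecture.FinalStateConjecture.Theorems.NearExtremalKappaCapture.UnitTemperatureFrontFace

end
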